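import Summits.PneNP.PneNP.Theorems.PhaseTwinsMacroscopicTwinsAboveHighActivityDefs

/-!
# Route PhaseTwins, item `MacroscopicTwinsAbove` (stmt-PneNP-2720), high-activity regime:
# the independence numbers of the two conflict-gadget twins

For the degree-3 conflict-gadget graphs `cgGraph E loc c` of `PhaseTwinsMacroscopicTwinsAboveHighActivityDefs`:

* `card_le_of_isIndepSet` — if every assignment violates at least `t` equations of `(E, c)`, every independent
  set of `cgGraph E loc c` has at most `4m(6D+2) + (m - t)` vertices. An independent set meets the gadget of a
  conflict-graph vertex `(e, S)` in at most `6D + 3` vertices (slot `0`, one of each pair connector `j`/slot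
  `j+1`, one of each fork), with equality only in the PICKED configuration (all slots and all `b`-vertices, by
  induction along the path); picked vertices of one equation coincide (same-equation conflict edges) and picked
  vertices agree on shared variables (cross-conflict edges), so they decode to ONE assignment satisfying the
  equation of every picked vertex — at most `m - t` of them.
* `isIndepSet_planted`, `card_planted` — in the satisfiable twin `cgGraph E loc 0` the planted set (gadget of
  `(e, 0)` picked, every other gadget contributing its connectors and `a`-vertices) is independent and has
  `4m(6D+2) + m` vertices.

Exact independence-number surgery in the style of Alimonti–Kann 2000 (vertex splitting, forks), carried out
directly on the uniform vertex type. [folklore]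
-/

noncomputable section

open scoped Classical BigOperators

namespace Summit.PneNP.PneNP.Theorems.MacroscopicTwinsAbove.HighActivity

open Finset
open Summit.PneNP.PneNP.Cruxes.MacroscopicTwinsAbove.LiteralGadgetsCfiApparatus (lgScope)
open Literature.ModelTheory.FiniteModelTheory.CFIMatching (bit)

-- `Summit.PneNP.PneNP.…` (summit = sub-problem name) trips the duplicate-namespace linter on every declaration.
set_option linter.dupNamespace false

variable {nv m D : ℕ}

/-! ## The far twin: upper bound -/

section Upper

variable {E : Fin m → Fin 3 → Fin nv} {loc : Fin m × Fin 3 → Fin D} {c : Fin m → ZMod 2}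

/-- Membership indicator. [folklore] -/
def ind (J : Finset (CGVert m D)) (x : CGVert m D) : ℕ := if x ∈ J then 1 else 0

/-- An indicator is at most one. [folklore] -/
theorem ind_le_one (J : Finset (CGVert m D)) (x : CGVert m D) : ind J x ≤ 1 := by
  unfold ind; split_ifs <;> simp

/-- Two adjacent vertices contribute at most one to an independent set. [folklore] -/
theorem ind_add_ind_le_one {J : Finset (CGVert m D)} (hJ : (cgGraph E loc c).IsIndepSet ↑J)
    {x y : CGVert m D} (h : (cgGraph E loc c).Adj x y) : ind J x + ind J y ≤ 1 := by
  unfold ind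
  by_cases hx : x ∈ J <;> by_cases hy : y ∈ J <;> simp [hx, hy]
  exact hJ (Finset.mem_coe.2 hx) (Finset.mem_coe.2 hy) h.ne h

/-- The number of vertices of `J` in the gadget of `(e, S)`. [folklore] -/
def gc (J : Finset (CGVert m D)) (e : Fin m) (S : Fin 2 → ZMod 2) : ℕ :=
  (Finset.univ.filter fun p : CGPiece D => ((e, S, p) : CGVert m D) ∈ J).card

/-- `|J|` is the sum of its gadget counts. [folklore] -/
theorem card_eq_sum_gc (J : Finset (CGVert m D)) : J.card = ∑ e : Fin m, ∑ S : Fin 2 → ZMod 2, gc J e S := by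
  have h1 : J.card = ∑ x : CGVert m D, (if x ∈ J then 1 else 0 : ℕ) := by
    rw [← Finset.card_filter, Finset.filter_mem_eq_inter, Finset.univ_inter]
  rw [h1, Fintype.sum_prod_type]
  refine Finset.sum_congr rfl fun e _ => ?_
  rw [Fintype.sum_prod_type]
  refine Finset.sum_congr rfl fun S _ => ?_
  rw [gc, Finset.card_filter]

/-- The gadget count split along the path (slot `0`; connector `j` with slot `j+1`) and the forks. [folklore] -/
theorem gc_eq (J : Finset (CGVert m D)) (e : Fin m) (S : Fin 2 → ZMod 2) :
    gc J e S = ind J (vS e S 0) + ∑ j : Fin (3 * D + 2), (ind J (vC e S j) + ind J (vS e S j.succ)) +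
      ∑ π : Fin 3 × Fin D, (ind J (vA e S π) + ind J (vB e S π)) := by
  rw [gc, Finset.card_filter, Fintype.sum_sum_type, Fintype.sum_sum_type, Fintype.sum_sum_type,
    Fin.sum_univ_succ, Finset.sum_add_distrib, Finset.sum_add_distrib]
  simp only [ind, vS, vC, vA, vB]
  ring

/-- **The gadget bound**: an independent set meets each gadget in at most `6D + 3` vertices. [folklore] -/
theorem gc_le {J : Finset (CGVert m D)} (hJ : (cgGraph E loc c).IsIndepSet ↑J) (e : Fin m)
    (S : Fin 2 → ZMod 2) : gc J e S ≤ 3 * D + 2 + 3 * D + 1 := by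
  rw [gc_eq]
  have h1 : ind J (vS e S 0) ≤ 1 := ind_le_one J _
  have h2 : ∑ j : Fin (3 * D + 2), (ind J (vC e S j) + ind J (vS e S j.succ)) ≤ 3 * D + 2 := by
    calc ∑ j : Fin (3 * D + 2), (ind J (vC e S j) + ind J (vS e S j.succ))
        ≤ ∑ _j : Fin (3 * D + 2), 1 :=
          Finset.sum_le_sum fun j _ => ind_add_ind_le_one hJ (adj_vC_succ E loc c e S j)
      _ = 3 * D + 2 := by simp
  have h3 : ∑ π : Fin 3 × Fin D, (ind J (vA e S π) + ind J (vB e S π)) ≤ 3 * D := by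
    calc ∑ π : Fin 3 × Fin D, (ind J (vA e S π) + ind J (vB e S π))
        ≤ ∑ _π : Fin 3 × Fin D, 1 :=
          Finset.sum_le_sum fun π _ => ind_add_ind_le_one hJ (adj_vA_vB E loc c e S π)
      _ = 3 * D := by simp
  omega

/-- `(e, S)` is PICKED by `J`: all its slots and all its `b`-fork vertices lie in `J`. [folklore] -/
def Picked (J : Finset (CGVert m D)) (e : Fin m) (S : Fin 2 → ZMod 2) : Prop :=
  (∀ σ, vS e S σ ∈ J) ∧ ∀ π, vB e S π ∈ J

/-- **Equality in the gadget bound forces the picked configuration**: slot `0` lies in `J`, every pair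
(connector `j`, slot `j+1`) and every fork contributes exactly one; by induction along the path every slot lies
in `J` (the connector before it does not), hence no `a`-vertex does and every `b`-vertex does. [folklore] -/
theorem picked_of_gc_eq {J : Finset (CGVert m D)} (hJ : (cgGraph E loc c).IsIndepSet ↑J) {e : Fin m}
    {S : Fin 2 → ZMod 2} (h : gc J e S = 3 * D + 2 + 3 * D + 1) : Picked J e S := by
  rw [gc_eq] at h
  have h1 : ind J (vS e S 0) ≤ 1 := ind_le_one J _
  have h2t : ∀ j : Fin (3 * D + 2), ind J (vC e S j) + ind J (vS e S j.succ) ≤ 1 :=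
    fun j => ind_add_ind_le_one hJ (adj_vC_succ E loc c e S j)
  have h3t : ∀ π : Fin 3 × Fin D, ind J (vA e S π) + ind J (vB e S π) ≤ 1 :=
    fun π => ind_add_ind_le_one hJ (adj_vA_vB E loc c e S π)
  have h2 : ∑ j : Fin (3 * D + 2), (ind J (vC e S j) + ind J (vS e S j.succ)) ≤
      ∑ _j : Fin (3 * D + 2), (1 : ℕ) := Finset.sum_le_sum fun j _ => h2t j
  have h3 : ∑ π : Fin 3 × Fin D, (ind J (vA e S π) + ind J (vB e S π)) ≤
      ∑ _π : Fin 3 × Fin D, (1 : ℕ) := Finset.sum_le_sum fun π _ => h3t π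
  have hc2 : ∑ _j : Fin (3 * D + 2), (1 : ℕ) = 3 * D + 2 := by simp
  have hc3 : ∑ _π : Fin 3 × Fin D, (1 : ℕ) = 3 * D := by simp
  -- every part attains its bound
  have e1 : ind J (vS e S 0) = 1 := by omega
  have e2 : ∑ j : Fin (3 * D + 2), (ind J (vC e S j) + ind J (vS e S j.succ)) =
      ∑ _j : Fin (3 * D + 2), (1 : ℕ) := by omega
  have e3 : ∑ π : Fin 3 × Fin D, (ind J (vA e S π) + ind J (vB e S π)) =
      ∑ _π : Fin 3 × Fin D, (1 : ℕ) := by omega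
  rw [Finset.sum_eq_sum_iff_of_le fun j _ => h2t j] at e2
  rw [Finset.sum_eq_sum_iff_of_le fun π _ => h3t π] at e3
  have hmem : ∀ x, ind J x = 1 → x ∈ J := fun x hx => by
    unfold ind at hx; split_ifs at hx with hm; exact hm
  have hnot : ∀ x, ind J x = 0 → x ∉ J := fun x hx => by
    unfold ind at hx; split_ifs at hx with hm; exact hm
  -- induction along the path
  have hslots : ∀ σ : Fin (3 * D + 2 + 1), vS e S σ ∈ J := by
    intro σ
    induction σ using Fin.induction with
    | zero => exact hmem _ e1
    | succ j ih =>
      have hj := e2 j (Finset.mem_univ _)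
      have hC : vC e S j ∉ J := fun hC =>
        hJ (Finset.mem_coe.2 hC) (Finset.mem_coe.2 ih) (adj_vC_castSucc E loc c e S j).ne
          (adj_vC_castSucc E loc c e S j)
      have hC0 : ind J (vC e S j) = 0 := by unfold ind; rw [if_neg hC]
      rw [hC0, zero_add] at hj
      exact hmem _ hj
  refine ⟨hslots, fun π => ?_⟩
  have hπ := e3 π (Finset.mem_univ _)
  have hA : vA e S π ∉ J := fun hA =>
    hJ (Finset.mem_coe.2 (hslots (forkSlot D π))) (Finset.mem_coe.2 hA) (adj_forkSlot_vA E loc c e S π).ne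
      (adj_forkSlot_vA E loc c e S π)
  have hA0 : ind J (vA e S π) = 0 := by unfold ind; rw [if_neg hA]
  rw [hA0, zero_add] at hπ
  exact hmem _ hπ

/-- The gadget count is at most `6D + 2`, plus one if `(e, S)` is picked. [folklore] -/
theorem gc_le_picked {J : Finset (CGVert m D)} (hJ : (cgGraph E loc c).IsIndepSet ↑J) (e : Fin m)
    (S : Fin 2 → ZMod 2) : gc J e S ≤ 3 * D + 2 + 3 * D + (if Picked J e S then 1 else 0) := by
  have h := gc_le hJ e S
  split_ifs with hp
  · exact h
  · have : gc J e S ≠ 3 * D + 2 + 3 * D + 1 := fun h' => hp (picked_of_gc_eq hJ h')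
    omega

/-- **Two picked vertices of the same equation coincide** (else their same-equation slots of the direction of
their difference are adjacent and both in `J`). [folklore] -/
theorem picked_unique {J : Finset (CGVert m D)} (hJ : (cgGraph E loc c).IsIndepSet ↑J) {e : Fin m}
    {S S' : Fin 2 → ZMod 2} (hS : Picked J e S) (hS' : Picked J e S') : S = S' := by
  by_contra hne
  have hd : S' - S ≠ 0 := sub_ne_zero.2 (Ne.symm hne)
  obtain ⟨i, hi⟩ := exists_dvec_eq hd
  have hS'eq : S' = S + dvec i := by rw [hi]; abel
  have hadj := adj_dirSlot E loc c e S i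
  rw [← hS'eq] at hadj
  exact hJ (Finset.mem_coe.2 (hS.1 _)) (Finset.mem_coe.2 (hS'.1 _)) hadj.ne hadj

/-- **Picked vertices agree on shared variables** (else the corresponding `b`-fork vertices are adjacent and both
in `J`). [folklore] -/
theorem picked_consistent {J : Finset (CGVert m D)} (hJ : (cgGraph E loc c).IsIndepSet ↑J) {e e' : Fin m}
    {S S' : Fin 2 → ZMod 2} (hS : Picked J e S) (hS' : Picked J e' S') {i i' : Fin 3}
    (hx : E e' i' = E e i) : bit (c e) S i = bit (c e') S' i' := by
  by_contra hne
  have hadj := adj_vB_vB E loc c hx hne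
  exact hJ (Finset.mem_coe.2 (hS.2 _)) (Finset.mem_coe.2 (hS'.2 _)) hadj.ne hadj

/-- The set of picked conflict-graph vertices. [folklore] -/
def pickedSet (J : Finset (CGVert m D)) : Finset (Fin m × (Fin 2 → ZMod 2)) :=
  Finset.univ.filter fun v => Picked J v.1 v.2

/-- The assignment decoded from an independent set: a variable occurring in a picked vertex gets the value that
vertex represents (well defined by `picked_consistent`), other variables get `0`. [folklore] -/
def decode (E : Fin m → Fin 3 → Fin nv) (c : Fin m → ZMod 2) (J : Finset (CGVert m D)) (x : Fin nv) : ZMod 2 :=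
  if h : ∃ q : (Fin m × (Fin 2 → ZMod 2)) × Fin 3, Picked J q.1.1 q.1.2 ∧ E q.1.1 q.2 = x then
    bit (c h.choose.1.1) h.choose.1.2 h.choose.2
  else 0

/-- The decoded assignment represents every picked vertex. [folklore] -/
theorem decode_eq {J : Finset (CGVert m D)} (hJ : (cgGraph E loc c).IsIndepSet ↑J) {e : Fin m}
    {S : Fin 2 → ZMod 2} (hS : Picked J e S) (i : Fin 3) : decode E c J (E e i) = bit (c e) S i := by
  unfold decode
  have hex : ∃ q : (Fin m × (Fin 2 → ZMod 2)) × Fin 3, Picked J q.1.1 q.1.2 ∧ E q.1.1 q.2 = E e i :=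
    ⟨((e, S), i), hS, rfl⟩
  rw [dif_pos hex]
  exact (picked_consistent hJ hS hex.choose_spec.1 hex.choose_spec.2).symm

/-- The decoded assignment satisfies the equation of every picked vertex. [folklore] -/
theorem decode_satisfies {J : Finset (CGVert m D)} (hJ : (cgGraph E loc c).IsIndepSet ↑J) {e : Fin m}
    {S : Fin 2 → ZMod 2} (hS : Picked J e S) : ∑ i : Fin 3, decode E c J (E e i) = c e := by
  simp only [decode_eq hJ hS, Fin.sum_univ_three]
  exact sum_bit (c e) S

/-- **The independence number of the far twin**: if every assignment violates at least `t` equations of `(E, c)`,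
every independent set of `cgGraph E loc c` has at most `4m(6D+2) + (m - t)` vertices — the gadget bound summed over
the `4m` gadgets, plus at most one picked vertex per equation SATISFIED by the decoded assignment. [folklore] -/
theorem card_le_of_isIndepSet {J : Finset (CGVert m D)} (hJ : (cgGraph E loc c).IsIndepSet ↑J) {t : ℕ}
    (hfar : ∀ f : Fin nv → ZMod 2, t ≤ (Finset.univ.filter fun e : Fin m => ∑ i : Fin 3, f (E e i) ≠ c e).card) :
    J.card ≤ 4 * m * (6 * D + 2) + (m - t) := by
  -- the picked vertices project injectively into the satisfied equations
  set sat : Finset (Fin m) := Finset.univ.filter fun e : Fin m => ∑ i : Fin 3, decode E c J (E e i) = c e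
  have hproj : (pickedSet J).card ≤ sat.card := by
    refine Finset.card_le_card_of_injOn Prod.fst (fun v hv => ?_) (fun v hv v' hv' hvv => ?_)
    · have hp : Picked J v.1 v.2 := (Finset.mem_filter.1 (Finset.mem_coe.1 hv)).2
      exact Finset.mem_filter.2 ⟨Finset.mem_univ _, decode_satisfies hJ hp⟩
    · have hp : Picked J v.1 v.2 := (Finset.mem_filter.1 (Finset.mem_coe.1 hv)).2
      have hp' : Picked J v'.1 v'.2 := (Finset.mem_filter.1 (Finset.mem_coe.1 hv')).2
      have h1 : v.1 = v'.1 := hvv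
      rw [h1] at hp
      exact Prod.ext h1 (picked_unique hJ hp hp')
  have hsat : sat.card + t ≤ m := by
    have h := hfar (decode E c J)
    have hdisj : Disjoint sat (Finset.univ.filter fun e : Fin m => ∑ i : Fin 3, decode E c J (E e i) ≠ c e) :=
      Finset.disjoint_filter.2 fun e _ h1 h2 => h2 h1
    have hcard := Finset.card_union_of_disjoint hdisj
    have hle : (sat ∪ Finset.univ.filter fun e : Fin m => ∑ i : Fin 3, decode E c J (E e i) ≠ c e).card ≤ m :=
      (Finset.card_le_univ _).trans (by simp)
    omega
  -- sum the gadget bounds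
  have hsum : J.card ≤ ∑ e : Fin m, ∑ S : Fin 2 → ZMod 2, (3 * D + 2 + 3 * D + (if Picked J e S then 1 else 0)) := by
    rw [card_eq_sum_gc]
    exact Finset.sum_le_sum fun e _ => Finset.sum_le_sum fun S _ => gc_le_picked hJ e S
  have hcount : ∑ e : Fin m, ∑ S : Fin 2 → ZMod 2, (3 * D + 2 + 3 * D + (if Picked J e S then 1 else 0)) =
      4 * m * (6 * D + 2) + (pickedSet J).card := by
    have hps : (pickedSet J).card = ∑ e : Fin m, ∑ S : Fin 2 → ZMod 2, (if Picked J e S then 1 else 0 : ℕ) := by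
      rw [pickedSet, Finset.card_filter, Fintype.sum_prod_type]
    rw [hps]
    simp only [Finset.sum_add_distrib, Finset.sum_const, Finset.card_univ, smul_eq_mul, Fintype.card_fun,
      ZMod.card, Fintype.card_fin]
    ring
  rw [hcount] at hsum
  omega

end Upper

/-! ## The satisfiable twin: the planted set -/

section Planted

variable (E : Fin m → Fin 3 → Fin nv) (loc : Fin m × Fin 3 → Fin D)

/-- No generating edge of `cgGraph E loc 0` joins two planted vertices. [folklore] -/
theorem not_cgRel_planted {x y : CGVert m D} (hx : InPlanted x) (hy : InPlanted y) :
    ¬ cgRel E loc (0 : Fin m → ZMod 2) x y := by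
  obtain ⟨e, S, p⟩ := x
  obtain ⟨e', S', p'⟩ := y
  rcases p with σ | j | π | π <;> rcases p' with σ' | j' | π' | π' <;>
    simp only [cgRel, InPlanted, Pi.zero_apply, not_false_eq_true] at hx hy ⊢
  · -- slot / slot
    rintro ⟨-, -, -, hS⟩
    rw [hx, hy, zero_add] at hS
    exact dvec_ne_zero _ hS.symm
  · -- slot / fork a
    rintro ⟨-, hS, -⟩
    exact hy (hS.trans hx)
  · -- connector / slot
    rintro ⟨-, hS, -⟩
    exact hx (hS.symm.trans hy)
  · -- fork a / fork b
    rintro ⟨-, hS, -⟩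
    exact hx (hS.symm.trans hy)
  · -- fork b / fork b
    rintro ⟨-, -, -, hne⟩
    rw [hx, hy, bit_zero_zero, bit_zero_zero] at hne
    exact hne rfl

/-- **The planted set is independent** in the satisfiable twin. [folklore] -/
theorem isIndepSet_planted : (cgGraph E loc (0 : Fin m → ZMod 2)).IsIndepSet ↑(planted m D) := by
  intro x hx y hy _ hadj
  have hx' : InPlanted x := (Finset.mem_filter.1 (Finset.mem_coe.1 hx)).2
  have hy' : InPlanted y := (Finset.mem_filter.1 (Finset.mem_coe.1 hy)).2
  rw [cgGraph_adj] at hadj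
  rcases hadj.2 with h | h
  · exact not_cgRel_planted E loc hx' hy' h
  · exact not_cgRel_planted E loc hy' hx' h

/-- The planted set inside one gadget: `6D + 3` vertices for `S = 0`, `6D + 2` otherwise. [folklore] -/
theorem card_planted_fibre (e : Fin m) (S : Fin 2 → ZMod 2) :
    (Finset.univ.filter fun p : CGPiece D => InPlanted ((e, S, p) : CGVert m D)).card =
      3 * D + 2 + 3 * D + (if S = 0 then 1 else 0) := by
  rw [Finset.card_filter, Fintype.sum_sum_type, Fintype.sum_sum_type, Fintype.sum_sum_type]
  simp only [InPlanted]
  by_cases hS : S = 0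
  · simp only [hS, ↓reduceIte, Finset.sum_const, Finset.card_univ, Fintype.card_fin, smul_eq_mul, mul_one,
      ne_eq, not_true_eq_false, mul_zero, Fintype.card_prod]
    ring
  · simp only [hS, ↓reduceIte, Finset.sum_const, Finset.card_univ, Fintype.card_fin, smul_eq_mul, mul_one,
      ne_eq, not_false_eq_true, mul_zero, Fintype.card_prod]
    ring

/-- **The size of the planted set**: `4m(6D+2) + m`. [folklore] -/
theorem card_planted (m D : ℕ) : (planted m D).card = 4 * m * (6 * D + 2) + m := by
  rw [planted, Finset.card_filter, Fintype.sum_prod_type]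
  simp_rw [Fintype.sum_prod_type (f := fun y : (Fin 2 → ZMod 2) × CGPiece D => if InPlanted (_, y) then 1 else 0)]
  have hfib : ∀ (e : Fin m) (S : Fin 2 → ZMod 2),
      (∑ p : CGPiece D, if InPlanted ((e, S, p) : CGVert m D) then 1 else 0) =
        3 * D + 2 + 3 * D + (if S = 0 then 1 else 0) := by
    intro e S
    rw [← Finset.card_filter]
    exact card_planted_fibre e S
  simp_rw [hfib]
  have hS : ∑ S : Fin 2 → ZMod 2, (3 * D + 2 + 3 * D + (if S = 0 then 1 else 0)) = 4 * (6 * D + 2) + 1 := by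
    rw [Finset.sum_add_distrib, Finset.sum_const, Finset.card_univ, Finset.sum_ite_eq' Finset.univ (0 : Fin 2 → ZMod 2)]
    simp only [Fintype.card_fun, ZMod.card, Fintype.card_fin, smul_eq_mul, Finset.mem_univ, ↓reduceIte]
    ring
  rw [Finset.sum_congr rfl fun e _ => hS, Finset.sum_const, Finset.card_univ, Fintype.card_fin, smul_eq_mul]
  ring


end Planted

end Summit.PneNP.PneNP.Theorems.MacroscopicTwinsAbove.HighActivity
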